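import Summits.BirchSwinnertonDyer.BirchSwinnertonDyer.Theorems.QuadraticBranchSignedControlPlusEtaLowerInclusionFunctionalEquationSqueezeUnitCoeff
import Summits.BirchSwinnertonDyer.BirchSwinnertonDyer.Theorems.QuadraticBranchSignedControlPlusEtaLowerInclusionTamagawaRoadLevel
import Summits.BirchSwinnertonDyer.Rank1Residual.X11b.BDPRouteTamagawaSupport
import Summits.BirchSwinnertonDyer.BirchSwinnertonDyer.Theorems.QuadraticBranchSignedControlPlusEtaNonsurjPrimeLFunctionShape
import HarnessLib

/-!
# Route `QuadraticBranchSignedControl` (rung K8, cell `bsd-potss`), crux `PlusEtaLowerInclusion`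
# (item stmt-BirchSwinnertonDyer-19601): the FUNCTIONAL-EQUATION SQUEEZE IN STUB CURRENCY — the
# registered hardest stub `stub_etaLower_tamagawaRows` on the W-INTRINSIC analytic sub-locus
# `λ(L_p⁺(V,η)) ≤ rank W + 2, μ = 0`, modulo named facts (seat `bsd-potss-k8eta-c1` g12; `--supports` 19601)

WHAT. Gen 11's road (p621603 `quadraticBranchPlusEta_pair_of_namedFacts_of_invol_of_unitCoeff_of_torsionDvd`)
derives (E⁺_η) ∧ (C1⁺_η) at a tower-onto pair from the named facts + B. D. Kim's functional equation at
`η` + the analytic shape `coeff_r L_p⁺(V,η,T) ≠ 0 ∧ p ∤ coeff_{r+2}` (`r = rank W`) + ONE factor of `p` in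
`#(X_η/TX_η)_tors`; its §2 supplied that factor PER ROW from a kernel Tate certificate with exactly two
Tamagawa-`p` primes. THIS FILE removes the row certificate: the factor of `p` comes from W-INTRINSIC
hypotheses through gen 4's level-`p^k` Tamagawa road
(`pow_dvd_natCard_torsion_coinvariants_of_namedFacts_of_poitouTate_of_tamagawa_level`, `v = 1`):
* §1 `etaPair_of_namedFacts_of_invol_of_unitCoeff_of_tamagawaLevel` — abstract form: ANY finite set
  `T ∌ 𝔭` of places containing every `v ≠ 𝔭` with `p ∣ c_v(W)`, `ord_p c_w ≤ k` on `T`, `1 + k·r ≤ ∑_T ord_p c_w`;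
* §2 the W-intrinsic Tamagawa place set (`exists_tamagawaFinset`, from `finite_badPlaces_holds` and
  `localTamagawaNumber_eq_one_of_hasGoodReductionAt_holds`) and the split-prime reading `c_ℓ(W) = ord_ℓ Δ_min(W)`
  (`X11b.localTamagawaNumber_eq_padicValInt_of_split`, bridge `localTamagawaNumber_padic_eq_holds`);
* §3 THE STUB'S SUB-LOCI, class-wide in form, binders in the order of `Sig.stub_etaLower_tamagawaRows`:
  `stub_etaLower_tamagawaRows_rankZero_of_namedFacts_of_lambda_le_two` — in the stub's OWN currency
  `p ∣ ∏ c_ℓ(W)` (read as a split multiplicative `ℓ` with `p ∣ ord_ℓ Δ_min(W)` by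
  `X11b.dvd_tamagawaProduct_iff_exists_split`; `ℓ ≠ p` because the partner is additive at `p`,
  `ne_of_split_of_smul_quadraticTwist_eq`): **rank W = 0, `L_p⁺(V,η,0) ≠ 0 ∧ p ∤ coeff₂` ⟹ (E⁺_η) ∧ (C1⁺_η)**;
  `tamagawaRows_rankOne_of_namedFacts_of_lambda_le_three` — rows named by TWO distinct split multiplicative
  primes with `p ∣ ord_ℓ Δ_min(W)` (the split-prime currency of p601509 `…_of_splitRows`): **rank W = 1,
  `coeff₁ ≠ 0 ∧ p ∤ coeff₃` ⟹ (E⁺_η) ∧ (C1⁺_η)**.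
No `L(W,1)`, no `#Ш_an`, no Kurihara number, no height, no per-row certificate: on these sub-loci ONE
Tamagawa factor sees one zero of `L_p⁺(V,η,T)/T^r` and the functional equation forces the other.
READING for the planner (numbers): of the 20 Tamagawa rows of the tower-onto census (j255146; 5 r0 + 15 r1),
10 lie on these sub-loci by the displayed PARI invariants (g3 ETALEAD `[λ⁺,λ⁻]`): r0 `λ⁺ = 2` 168150g1,
248550l1, 321450n1 (`ord₅ #Ш_an = 0`: already closed by the converse-control road p468146 with `#Ш_an` a `p`-unit); r1 two-prime
`λ⁺ = 3` 125400cx1, 150150ei1, 174450d1, 209550a1, 345450go1, 33150cf1, 69150v1 (closed by g4's road at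
`v_an = 1` / g11's record). NO census number moves (40/40); what is new is the CLASS-WIDE FORM: on
{`p ∣ Tam W`} ∩ {`λ⁺_η ≤ rank W + 2`, `μ⁺_η = 0`} ∩ {rank 0, or rank 1 with two Tamagawa-`p` primes} the
hardest stub holds modulo the named facts and the two displayed `V`-side certificates; its complement in
the stub is {`λ⁺_η ≥ rank W + 4`} ∪ {rank 1, one Tamagawa-`p` prime} ∪ {rank ≥ 2} (census: 231650m1,
288600bn1; 225150k1, 36075p1, 311850cf1, 366450bp1, 460950m1, 48300w1, 77350bi1; 499800hw1).

HONEST FRAMING (cell `bsd-potss`, run/shared/lean/pub/bsd-potss/; FULL-BSD rank ≤ 1 programme, HUMAN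
RULING D-0036/D-0074): TOOL THEOREMS, CONDITIONAL on the named Literature facts in hypothesis position
(Kobayashi 1.2/1.3/2.2η/4.1η, Kitajima–Otsuki 1.3η, B. D. Kim 3.11η, Poitou–Tate) and on displayed
per-pair inputs (`rank W(ℚ)`; on the twist `V`: tower onto, the `V`-certificate, the analytic shape).
Crux 19601 is OPEN class-wide and NOT closed; nothing is booked; `BSD(W, p)` is claimed for no pair. No
definition, no named fact, no `sorry`, axioms standard.

References: [KimBD2008MRL] Thm. 3.11 (p. 93); [Kobayashi2003] Thm. 2.2 (p. 5), §4 + Thm. 4.1 (p. 8), Thm. 9.3;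
[KitajimaOtsuki2018] Thm. 1.3; [MilneADT2006] I Thm. 4.10; [SilvermanATAEC1994] Cor. IV.9.2 (b),(d);
[SilvermanAEC2009] VII.5 Prop. 5.1, VIII.1 Remark 1.3; [Washington1997] §7.1, §13.2.
-/

set_option autoImplicit false
set_option linter.dupNamespace false

noncomputable section

open scoped Classical AddSubgroup NumberField

open CongruenceSubgroup Field NumberField IsDedekindDomain WeierstrassCurve Rat.HeightOneSpectrum
open Literature.NumberTheory.EllipticCurves
open Literature.NumberTheory.EllipticCurves.ModularForms
open Literature.NumberTheory.GaloisRepresentations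
open Literature.NumberTheory.GaloisCohomology
open Literature.NumberTheory.EllipticCurves.IwasawaDual
open Literature.NumberTheory.EllipticCurves.IwasawaAlgebra
open Summit.BirchSwinnertonDyer.Rank1Residual.Additive
open Summit.BirchSwinnertonDyer.BirchSwinnertonDyer.Rank2Observatory.Tam
open Summit.BirchSwinnertonDyer.Rank1Residual

namespace Summit.BirchSwinnertonDyer.BirchSwinnertonDyer.Theorems

/-! ## §1 The abstract form: any covering finite set of Tamagawa places -/

section Pair

variable {V : WeierstrassCurve ℚ} [V.IsElliptic] [V.IsGloballyMinimal] {p : ℕ} [hp : Fact p.Prime]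

/-- **(E⁺_η) ∧ (C1⁺_η) at a tower-onto pair from `λ(L_p⁺(V,η)) ≤ r + 2`, `μ = 0` and the Tamagawa
numbers of the partner — abstract form.** GRANTED Kobayashi 1.2/1.3/2.2η/4.1η, Kitajima–Otsuki 1.3η,
B. D. Kim 3.11η and Poitou–Tate (NAMED facts): on a good `a_p = 0` pair with `p ≥ 5`, `ρ_{V,p^m}` onto,
the `V`-certificate and the analytic shape `coeff_r L_p⁺(V,η,T) ≠ 0 ∧ p ∤ coeff_{r+2} L_p⁺(V,η,T)`
(`r = rank V^{(p*)}(ℚ)`), for a globally minimal partner `W` (`C • W^{(p*)} = V`) and ANY finite set `T`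
of finite places with `𝔭 ∉ T`, every `v ≠ 𝔭` with `p ∣ c_v(W)` in `T`, `ord_p c_w(W) ≤ k` on `T`
(`k ≥ 1`) and `1 + k·r ≤ ∑_{w ∈ T} ord_p c_w(W)`: (E⁺_η)(V,p) ∧ (C1⁺_η)(V,p). Proof: gen 4's
level-`p^k` Tamagawa road gives the ONE factor of `p` in `#(X_η/TX_η)_tors` that gen 11's
factorisation-free functional-equation squeeze consumes. CONDITIONAL; closes nothing class-wide.
[cite: KimBD2008MRL, Thm. 3.11 (p. 93)] [cite: Kobayashi2003, Thm. 2.2 (p. 5), §4 and Thm. 4.1 (p. 8), Thm. 9.3]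
[cite: KitajimaOtsuki2018, Thm. 1.3] [cite: MilneADT2006, Ch. I, Thm. 4.10] -/
theorem etaPair_of_namedFacts_of_invol_of_unitCoeff_of_tamagawaLevel
    (h12 : Kobayashi2003.thm12_signedSelmerDual_finite_torsion)
    (h13 : Kobayashi2003.thm41_signedCharIdeal_divisibility)
    (h22 : Kobayashi2003.thm22_etaSignedSelmerDual_finite_torsion)
    (h41 : Kobayashi2003.thm41_plusEtaCharIdeal_dvd)
    (hKO : KitajimaOtsuki2018.mainThm13_etaSignedSelmerDual_noFiniteSubmodule)
    (hFE : Kim2008.thm311_etaSignedSelmerDual_charIdeal_map_invol)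
    (hPT : poitouTate_selmerStructure_duality_real ℚ)
    (hp5 : 5 ≤ p) (hgood : V.HasGoodReductionAtPrime p) (hap : V.frobeniusTrace p = 0)
    (hsurj : ∀ m : ℕ, V.HasSurjectiveModNGaloisRep (p ^ m : ℕ))
    (hcertV : ∀ {N : ℕ} [NeZero N] (f : CuspForm (Gamma0 N) 2), IsNewformOf V f →
      ∃ L : IwasawaAlgebra p, Kobayashi2003.IsSignedPAdicLFunction f p 1 L ∧
        IsUnit (PowerSeries.coeff V.mordellWeilRank L))
    (han2 : ∀ {N : ℕ} [NeZero N] {f : CuspForm (Gamma0 N) 2}, IsNewformOf V f →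
      ∀ (ϖ : ℚ), (if Even (p / 2) then (ϖ : ℝ) * V.realPeriodRat = plusPeriod f
          else (ϖ : ℝ) * V.imaginaryPeriodRat = minusPeriod f) →
      ∀ (Lη : IwasawaAlgebra p), IsQuadraticBranchPlusLFunction f p ϖ Lη →
        PowerSeries.coeff (V.quadraticTwist ((-1) ^ (p / 2) * p)).mordellWeilRank Lη ≠ 0 ∧
          ¬ (p : ℤ_[p]) ∣ PowerSeries.coeff ((V.quadraticTwist ((-1) ^ (p / 2) * p)).mordellWeilRank + 2) Lη)
    (W : WeierstrassCurve ℚ) [W.IsElliptic] [W.IsGloballyMinimal] (C : VariableChange ℚ)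
    (hCV : C • W.quadraticTwist ((-1) ^ (p / 2) * p) = V)
    (T : Finset (HeightOneSpectrum (𝓞 ℚ)))
    (hpT : (Rat.HeightOneSpectrum.primesEquiv (R := 𝓞 ℚ)).symm ⟨p, hp.out⟩ ∉ T)
    (hT : ∀ v : HeightOneSpectrum (𝓞 ℚ), v ≠ (Rat.HeightOneSpectrum.primesEquiv (R := 𝓞 ℚ)).symm ⟨p, hp.out⟩ →
      p ∣ (W.baseChange (v.adicCompletion ℚ)).localTamagawaNumber (v.adicCompletionIntegers ℚ) → v ∈ T)
    (k : ℕ) (hk : 1 ≤ k)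
    (hTk : ∀ w ∈ T, padicValNat p ((W.baseChange (w.adicCompletion ℚ)).localTamagawaNumber
      (w.adicCompletionIntegers ℚ)) ≤ k)
    (hsum : 1 + k * (V.quadraticTwist ((-1) ^ (p / 2) * p)).mordellWeilRank ≤
      ∑ w ∈ T, padicValNat p ((W.baseChange (w.adicCompletion ℚ)).localTamagawaNumber
        (w.adicCompletionIntegers ℚ))) :
    QuadraticBranchPlusEtaLowerInclusionAt V p ∧ QuadraticBranchPlusEtaMainConjectureAt V p := by
  refine quadraticBranchPlusEta_pair_of_namedFacts_of_invol_of_unitCoeff_of_torsionDvd h12 h13 h22 h41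
    hKO hFE hp5 hgood hap hsurj (fun f hf => hcertV f hf) (fun hf => han2 hf) ?_
  intro K₀ _ _ _ _ ηq hηK hη1 κ γ hκ hγ hγK hγc N _ f hf ϖ hϖ Lη hL hne D
  have h := pow_dvd_natCard_torsion_coinvariants_of_namedFacts_of_poitouTate_of_tamagawa_level h12 h13
    h22 h41 hPT hp5 hgood hap hsurj (fun f hf => hcertV f hf) hf ϖ hϖ Lη hL hne W C hCV T hpT hT k hk hTk
    K₀ ηq hηK hη1 κ γ hκ hγ hγK hγc D 1 hsum
  rwa [pow_one] at h

end Pair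

/-! ## §2 The W-intrinsic Tamagawa place set and the split-prime reading -/

section Places

variable (W : WeierstrassCurve ℚ) [W.IsElliptic]

/-- **The Tamagawa-`p` places of `W` away from `𝔭` form a finite set** with the two covering properties
of the Tamagawa road: `T = {v bad for W : v ≠ 𝔭, p ∣ c_v(W)}` — finite by `finite_badPlaces_holds`
(Silverman VIII.1 Remark 1.3), covering because `c_v = 1` at good places
(`localTamagawaNumber_eq_one_of_hasGoodReductionAt_holds`). Pure bookkeeping.
[cite: SilvermanAEC2009, VIII.1 Remark 1.3 and VII.5 Prop. 5.1] -/
theorem exists_tamagawaFinset (p : ℕ) [hp : Fact p.Prime] :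
    ∃ T : Finset (HeightOneSpectrum (𝓞 ℚ)),
      (Rat.HeightOneSpectrum.primesEquiv (R := 𝓞 ℚ)).symm ⟨p, hp.out⟩ ∉ T ∧
      (∀ v : HeightOneSpectrum (𝓞 ℚ), v ≠ (Rat.HeightOneSpectrum.primesEquiv (R := 𝓞 ℚ)).symm ⟨p, hp.out⟩ →
        p ∣ (W.baseChange (v.adicCompletion ℚ)).localTamagawaNumber (v.adicCompletionIntegers ℚ) → v ∈ T) ∧
      (∀ w ∈ T, w ≠ (Rat.HeightOneSpectrum.primesEquiv (R := 𝓞 ℚ)).symm ⟨p, hp.out⟩ ∧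
        p ∣ (W.baseChange (w.adicCompletion ℚ)).localTamagawaNumber (w.adicCompletionIntegers ℚ)) := by
  have hfin : (W.badPlaces (𝓞 ℚ)).Finite := W.finite_badPlaces_holds (𝓞 ℚ)
  refine ⟨hfin.toFinset.filter (fun v => v ≠ (Rat.HeightOneSpectrum.primesEquiv (R := 𝓞 ℚ)).symm ⟨p, hp.out⟩ ∧
      p ∣ (W.baseChange (v.adicCompletion ℚ)).localTamagawaNumber (v.adicCompletionIntegers ℚ)), ?_, ?_, ?_⟩
  · intro h
    exact ((Finset.mem_filter.mp h).2.1) rfl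
  · intro v hv hdvd
    refine Finset.mem_filter.mpr ⟨?_, hv, hdvd⟩
    rw [Set.Finite.mem_toFinset, mem_badPlaces_iff]
    intro hgood
    rw [W.localTamagawaNumber_eq_one_of_hasGoodReductionAt_holds v hgood, Nat.dvd_one] at hdvd
    exact hp.out.one_lt.ne' hdvd
  · intro w hw
    exact (Finset.mem_filter.mp hw).2

/-- **`p ∣ c_𝔩(W)` at the place `𝔩 = pl ℓ` of a split multiplicative prime `ℓ` with `p ∣ ord_ℓ Δ_min(W)`**
(Kodaira–Néron: `c_ℓ = ord_ℓ Δ_min` at a split multiplicative prime, tree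
`X11b.localTamagawaNumber_eq_padicValInt_of_split`; place / `p`-adic currency bridge
`localTamagawaNumber_padic_eq_holds`). [cite: SilvermanATAEC1994, Cor. IV.9.2 (d) with (b)] -/
theorem dvd_localTamagawaNumber_pl_of_split [W.IsGloballyMinimal] (p : ℕ) {ℓ : ℕ} [hℓ : Fact ℓ.Prime]
    (hs : W.HasSplitMultiplicativeReductionAtPrime ℓ) (hd : p ∣ padicValInt ℓ W.minimalDiscriminantInt) :
    p ∣ (W.baseChange ((pl ℓ).adicCompletion ℚ)).localTamagawaNumber ((pl ℓ).adicCompletionIntegers ℚ) := by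
  have hv : (Rat.HeightOneSpectrum.primesEquiv (R := 𝓞 ℚ) (pl ℓ) : ℕ) = ℓ := natGenerator_pl hℓ.out
  rw [← W.localTamagawaNumber_padic_eq_holds (pl ℓ) ℓ hv]
  obtain ⟨v', hv'⟩ : ∃ v' : HeightOneSpectrum ℤ, (Rat.HeightOneSpectrum.primesEquiv (R := ℤ) v' : ℕ) = ℓ :=
    ⟨(Rat.HeightOneSpectrum.primesEquiv (R := ℤ)).symm ⟨ℓ, hℓ.out⟩, by rw [Equiv.apply_symm_apply]⟩
  rw [X11b.localTamagawaNumber_eq_padicValInt_of_split W v' hv' hs]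
  exact hd

/-- **`1 ≤ ord_p c_𝔩(W)`** at such a place (`c_𝔩 ≠ 0`: `localTamagawaNumber_padic_ne_zero_holds`).
[cite: SilvermanATAEC1994, Cor. IV.9.2 (d)] [cite: SilvermanAEC2009, Cor. VII.6.2] -/
theorem one_le_padicValNat_localTamagawaNumber_pl_of_split [W.IsGloballyMinimal] (p : ℕ) [hp : Fact p.Prime]
    {ℓ : ℕ} [hℓ : Fact ℓ.Prime] (hs : W.HasSplitMultiplicativeReductionAtPrime ℓ) (hd : p ∣ padicValInt ℓ W.minimalDiscriminantInt) :
    1 ≤ padicValNat p ((W.baseChange ((pl ℓ).adicCompletion ℚ)).localTamagawaNumber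
      ((pl ℓ).adicCompletionIntegers ℚ)) := by
  have hv : (Rat.HeightOneSpectrum.primesEquiv (R := 𝓞 ℚ) (pl ℓ) : ℕ) = ℓ := natGenerator_pl hℓ.out
  have hne : (W.baseChange ((pl ℓ).adicCompletion ℚ)).localTamagawaNumber ((pl ℓ).adicCompletionIntegers ℚ) ≠ 0 := by
    rw [← W.localTamagawaNumber_padic_eq_holds (pl ℓ) ℓ hv]
    haveI : (W.baseChange ℚ_[ℓ]).IsElliptic := by unfold WeierstrassCurve.baseChange; infer_instance
    exact localTamagawaNumber_padic_ne_zero_holds ℓ (W.baseChange ℚ_[ℓ])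
  have hdvd := dvd_localTamagawaNumber_pl_of_split W p hs hd
  exact one_le_padicValNat_of_dvd hne hdvd

omit [W.IsElliptic] in
/-- `pl ℓ ≠ 𝔭` for primes `ℓ ≠ p` (`pl` is injective on primes: `natGenerator_pl`). [folklore] -/
theorem pl_ne_of_ne (p : ℕ) [hp : Fact p.Prime] {ℓ : ℕ} (hℓ : ℓ.Prime) (hℓp : ℓ ≠ p) :
    pl ℓ ≠ (Rat.HeightOneSpectrum.primesEquiv (R := 𝓞 ℚ)).symm ⟨p, hp.out⟩ := by
  intro h
  apply hℓp
  have h1 : natGenerator (pl ℓ) = ℓ := natGenerator_pl hℓ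
  rw [h, ← TamagawaRoad.pl_eq_primesEquiv_symm p, natGenerator_pl hp.out] at h1
  exact h1.symm

end Places

/-! ## §3 The registered stub `stub_etaLower_tamagawaRows` on its analytic sub-loci (class-wide form) -/

section Stub

/-- `f a ≤ ∑_{x ∈ s} f x` for `ℕ`-valued `f` and `a ∈ s` (Mathlib's `Finset.single_le_sum`, packaged to
keep the elaborator away from the Tamagawa summand). [folklore] -/
theorem TamagawaLocus.le_sum_of_mem {ι : Type*} (s : Finset ι) (f : ι → ℕ) {a : ι} (h : a ∈ s) :
    f a ≤ ∑ x ∈ s, f x :=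
  Finset.single_le_sum (fun _ _ => Nat.zero_le _) h

/-- **A split multiplicative prime of the partner `W` is never `p`**: `C • W^{(p*)} = V` with `V` good at
`p` makes `W` additive at `p` (tree `addv_of_twist_pStar`, Silverman VII.5.1), while split multiplicative
reduction is multiplicative. [cite: SilvermanAEC2009, VII.5 Prop. 5.1] -/
theorem ne_of_split_of_smul_quadraticTwist_eq {V : WeierstrassCurve ℚ} [V.IsElliptic] [V.IsGloballyMinimal]
    {W : WeierstrassCurve ℚ} [W.IsElliptic] [W.IsGloballyMinimal] {C : VariableChange ℚ} {p : ℕ}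
    [hp : Fact p.Prime] (hp5 : 5 ≤ p) (hCV : C • W.quadraticTwist ((-1) ^ (p / 2) * p) = V)
    (hgood : V.HasGoodReductionAtPrime p) {ℓ : ℕ} [hℓ : Fact ℓ.Prime]
    (hs : W.HasSplitMultiplicativeReductionAtPrime ℓ) : ℓ ≠ p := by
  rintro rfl
  have hp2 : ℓ ≠ 2 := by omega
  have hd : ((-1 : ℚ) ^ (ℓ / 2) * ℓ) ≠ 0 :=
    mul_ne_zero (pow_ne_zero _ (neg_ne_zero.mpr one_ne_zero)) (Nat.cast_ne_zero.mpr hp.out.ne_zero)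
  haveI := W.isElliptic_quadraticTwist hd
  obtain ⟨C', hC'⟩ := exists_variableChange_quadraticTwist_symm (W := V) W hd ⟨C, hCV⟩
  have hjW : 0 ≤ padicValRat ℓ W.j := by
    have htw : (W.quadraticTwist ((-1 : ℚ) ^ (ℓ / 2) * ℓ)).HasGoodReductionAtPrime ℓ := by
      rw [← hCV] at hgood
      exact (BSZLemma17.hasGoodReductionAtPrime_smul_iff _ C ℓ).mp hgood
    exact padicValRat_j_nonneg_of_typeG W ℓ (typeG_of_hasGoodReductionAtPrime_quadraticTwist W ℓ hp2 htw)
  have hjV : 0 ≤ padicValRat ℓ V.j := by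
    have e : V.j = W.j := by subst hCV; rw [variableChange_j, j_quadraticTwist W hd]
    exact e ▸ hjW
  have hΔV : padicValInt ℓ V.minimalDiscriminantInt < 6 := by
    rw [padicValInt.eq_zero_of_not_dvd (not_dvd_minimalDiscriminantInt_of_hasGoodReductionAtPrime' V ℓ hgood)]
    norm_num
  obtain ⟨hadd, -, -⟩ := addv_of_twist_pStar ℓ hp2 V W hjV hΔV C' hC'
  exact hadd.2 hs.hasMultiplicativeReductionAtPrime

/-- **THE HARDEST STUB ON THE RANK-ZERO `λ ≤ 2` SUB-LOCUS, IN THE STUB'S OWN CURRENCY.** GRANTED the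
named facts (Kobayashi 1.2/1.3/2.2η/4.1η, Kitajima–Otsuki 1.3η, B. D. Kim 3.11η, Poitou–Tate): the binders
of `Sig.stub_etaLower_tamagawaRows` VERBATIM (`V`, `W`, `C`, `p`, `5 ≤ p`, `C • W^{(p*)} = V`, good,
`a_p(V) = 0`, tower onto, `p ∣ ∏ c_ℓ(W)`) followed by THREE displayed inputs — `rank W(ℚ) = 0`, the
`V`-certificate, and the ANALYTIC SHAPE `L_p⁺(V,η,0) ≠ 0 ∧ p ∤ coeff₂ L_p⁺(V,η,T)` (`μ = 0`, `λ ≤ 2`, for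
every branch function — they differ by units) — give the stub's conclusion (E⁺_η)(V,p) (and (C1⁺_η)).
No `L(W,1)`, no `#Ш_an(W)`, no Kurihara number, no row certificate. Proof: `p ∣ ∏ c_ℓ(W)` is a split
multiplicative `ℓ` with `p ∣ ord_ℓ Δ_min(W) = c_ℓ(W)` (`X11b.dvd_tamagawaProduct_iff_exists_split`, `p ≥ 5`),
`ℓ ≠ p` (`ne_of_split_of_smul_quadraticTwist_eq`), so the W-intrinsic place set `T` of §2 has
`S = ∑_T ord_p c_w ≥ 1`; §1 at level `k = S`, `r = 0`. CONDITIONAL; a SUB-LOCUS of the registered stub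
(which stays OPEN class-wide: `λ ≥ 4`, or rank `≥ 1`); closes nothing by itself; nothing booked;
`BSD(W,p)` claimed for no pair. [cite: KimBD2008MRL, Thm. 3.11 (p. 93)]
[cite: Kobayashi2003, Thm. 2.2 (p. 5), §4 Even main conjecture and Thm. 4.1 (p. 8), Thm. 9.3]
[cite: KitajimaOtsuki2018, Thm. 1.3] [cite: MilneADT2006, Ch. I, Thm. 4.10] [cite: SilvermanATAEC1994, Cor. IV.9.2 (d)] -/
theorem stub_etaLower_tamagawaRows_rankZero_of_namedFacts_of_lambda_le_two
    (h12 : Kobayashi2003.thm12_signedSelmerDual_finite_torsion)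
    (h13 : Kobayashi2003.thm41_signedCharIdeal_divisibility)
    (h22 : Kobayashi2003.thm22_etaSignedSelmerDual_finite_torsion)
    (h41 : Kobayashi2003.thm41_plusEtaCharIdeal_dvd)
    (hKO : KitajimaOtsuki2018.mainThm13_etaSignedSelmerDual_noFiniteSubmodule)
    (hFE : Kim2008.thm311_etaSignedSelmerDual_charIdeal_map_invol)
    (hPT : poitouTate_selmerStructure_duality_real ℚ)
    (V : WeierstrassCurve ℚ) [V.IsElliptic] [V.IsGloballyMinimal] (W : WeierstrassCurve ℚ)
    [W.IsElliptic] [W.IsGloballyMinimal] (C : VariableChange ℚ) (p : ℕ) [hp : Fact p.Prime]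
    (hp5 : 5 ≤ p) (hCV : C • W.quadraticTwist ((-1) ^ (p / 2) * p) = V)
    (hgood : V.HasGoodReductionAtPrime p) (hap : V.frobeniusTrace p = 0)
    (hsurj : ∀ m : ℕ, V.HasSurjectiveModNGaloisRep (p ^ m : ℕ)) (htam : p ∣ W.tamagawaProduct)
    (hr0 : W.mordellWeilRank = 0)
    (hcertV : ∀ {N : ℕ} [NeZero N] (f : CuspForm (Gamma0 N) 2), IsNewformOf V f →
      ∃ L : IwasawaAlgebra p, Kobayashi2003.IsSignedPAdicLFunction f p 1 L ∧
        IsUnit (PowerSeries.coeff V.mordellWeilRank L))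
    (han2 : ∀ {N : ℕ} [NeZero N] {f : CuspForm (Gamma0 N) 2}, IsNewformOf V f →
      ∀ (ϖ : ℚ), (if Even (p / 2) then (ϖ : ℝ) * V.realPeriodRat = plusPeriod f
          else (ϖ : ℝ) * V.imaginaryPeriodRat = minusPeriod f) →
      ∀ (Lη : IwasawaAlgebra p), IsQuadraticBranchPlusLFunction f p ϖ Lη →
        PowerSeries.coeff 0 Lη ≠ 0 ∧ ¬ (p : ℤ_[p]) ∣ PowerSeries.coeff 2 Lη) :
    QuadraticBranchPlusEtaLowerInclusionAt V p ∧ QuadraticBranchPlusEtaMainConjectureAt V p := by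
  obtain ⟨ℓ, hℓ, hs, hd⟩ := (X11b.dvd_tamagawaProduct_iff_exists_split W hp.out hp5).mp htam
  have hℓp : ℓ ≠ p := ne_of_split_of_smul_quadraticTwist_eq hp5 hCV hgood hs
  obtain ⟨T, hpT, hT, -⟩ := exists_tamagawaFinset W p
  have hd0 : ((-1 : ℚ) ^ (p / 2) * p) ≠ 0 :=
    mul_ne_zero (pow_ne_zero _ (by norm_num)) (Nat.cast_ne_zero.mpr hp.out.ne_zero)
  have hrk : (V.quadraticTwist ((-1) ^ (p / 2) * p)).mordellWeilRank = 0 := by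
    rw [TamagawaRoad.mordellWeilRank_quadraticTwist_eq_of_smul_quadraticTwist_eq hd0 hCV, hr0]
  have hmem : pl ℓ ∈ T :=
    hT (pl ℓ) (pl_ne_of_ne p hℓ.out hℓp) (dvd_localTamagawaNumber_pl_of_split W p hs hd)
  have hle : ∀ w ∈ T, padicValNat p ((W.baseChange (w.adicCompletion ℚ)).localTamagawaNumber
      (w.adicCompletionIntegers ℚ)) ≤ ∑ w ∈ T, padicValNat p ((W.baseChange (w.adicCompletion ℚ)).localTamagawaNumber
        (w.adicCompletionIntegers ℚ)) :=
    fun w hw => TamagawaLocus.le_sum_of_mem T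
      (fun x => padicValNat p ((W.baseChange (x.adicCompletion ℚ)).localTamagawaNumber (x.adicCompletionIntegers ℚ))) hw
  have h1 : 1 ≤ ∑ w ∈ T, padicValNat p ((W.baseChange (w.adicCompletion ℚ)).localTamagawaNumber
      (w.adicCompletionIntegers ℚ)) :=
    (one_le_padicValNat_localTamagawaNumber_pl_of_split W p hs hd).trans (hle _ hmem)
  refine etaPair_of_namedFacts_of_invol_of_unitCoeff_of_tamagawaLevel h12 h13 h22 h41 hKO hFE hPT hp5
    hgood hap hsurj (fun f hf => hcertV f hf) ?_ W C hCV T hpT hT _ h1 hle ?_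
  · intro N _ f hf ϖ hϖ Lη hL
    rw [hrk]
    exact han2 hf ϖ hϖ Lη hL
  · rw [hrk, mul_zero, add_zero]
    exact h1

/-- **THE HARDEST STUB ON THE RANK-ONE TWO-PRIME `λ ≤ 3` SUB-LOCUS.** Same binders and named facts, with
the Tamagawa rows named by TWO distinct split multiplicative primes `ℓ₁ ≠ ℓ₂` of `W` with
`p ∣ ord_{ℓ_i} Δ_min(W)` (`= c_{ℓ_i}(W)`; the split-prime currency of p601509 `…_of_splitRows`), IF
`rank W(ℚ) = 1` (DISPLAYED; GZK on an analytic-rank-one row) and the twist carries the `V`-certificate and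
the ANALYTIC SHAPE `coeff₁ L_p⁺(V,η,T) ≠ 0 ∧ p ∤ coeff₃` (`μ = 0`, `λ ≤ 3`), THEN (E⁺_η)(V,p) ∧ (C1⁺_η)(V,p):
`ℓ_i ≠ p` automatically; with `S = ∑_T ord_p c_w ≥ 2` the level is `k = S − 1` (the OTHER named prime
bounds each `ord_p c_w` by `S − 1`; `1 + k ≤ S`). Class-wide form of gen 11's record shape
`etaPair_of_rowCheck_of_tamagawaPair_of_unitCoeff`. CONDITIONAL; a sub-locus of an OPEN class-wide
statement; closes nothing by itself; nothing booked; `BSD(W,p)` claimed for no pair.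
[cite: KimBD2008MRL, Thm. 3.11 (p. 93)] [cite: Kobayashi2003, Thm. 2.2 (p. 5), §4 and Thm. 4.1 (p. 8), Thm. 9.3]
[cite: KitajimaOtsuki2018, Thm. 1.3] [cite: MilneADT2006, Ch. I, Thm. 4.10] [cite: SilvermanATAEC1994, Cor. IV.9.2 (d)] -/
theorem tamagawaRows_rankOne_of_namedFacts_of_lambda_le_three
    (h12 : Kobayashi2003.thm12_signedSelmerDual_finite_torsion)
    (h13 : Kobayashi2003.thm41_signedCharIdeal_divisibility)
    (h22 : Kobayashi2003.thm22_etaSignedSelmerDual_finite_torsion)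
    (h41 : Kobayashi2003.thm41_plusEtaCharIdeal_dvd)
    (hKO : KitajimaOtsuki2018.mainThm13_etaSignedSelmerDual_noFiniteSubmodule)
    (hFE : Kim2008.thm311_etaSignedSelmerDual_charIdeal_map_invol)
    (hPT : poitouTate_selmerStructure_duality_real ℚ)
    (V : WeierstrassCurve ℚ) [V.IsElliptic] [V.IsGloballyMinimal] (W : WeierstrassCurve ℚ)
    [W.IsElliptic] [W.IsGloballyMinimal] (C : VariableChange ℚ) (p : ℕ) [hp : Fact p.Prime]
    (hp5 : 5 ≤ p) (hCV : C • W.quadraticTwist ((-1) ^ (p / 2) * p) = V)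
    (hgood : V.HasGoodReductionAtPrime p) (hap : V.frobeniusTrace p = 0)
    (hsurj : ∀ m : ℕ, V.HasSurjectiveModNGaloisRep (p ^ m : ℕ))
    {ℓ₁ ℓ₂ : ℕ} [hℓ₁ : Fact ℓ₁.Prime] [hℓ₂ : Fact ℓ₂.Prime] (hℓ₁₂ : ℓ₁ ≠ ℓ₂)
    (hs₁ : W.HasSplitMultiplicativeReductionAtPrime ℓ₁) (hs₂ : W.HasSplitMultiplicativeReductionAtPrime ℓ₂)
    (hd₁ : p ∣ padicValInt ℓ₁ W.minimalDiscriminantInt) (hd₂ : p ∣ padicValInt ℓ₂ W.minimalDiscriminantInt)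
    (hr1 : W.mordellWeilRank = 1)
    (hcertV : ∀ {N : ℕ} [NeZero N] (f : CuspForm (Gamma0 N) 2), IsNewformOf V f →
      ∃ L : IwasawaAlgebra p, Kobayashi2003.IsSignedPAdicLFunction f p 1 L ∧
        IsUnit (PowerSeries.coeff V.mordellWeilRank L))
    (han2 : ∀ {N : ℕ} [NeZero N] {f : CuspForm (Gamma0 N) 2}, IsNewformOf V f →
      ∀ (ϖ : ℚ), (if Even (p / 2) then (ϖ : ℝ) * V.realPeriodRat = plusPeriod f
          else (ϖ : ℝ) * V.imaginaryPeriodRat = minusPeriod f) →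
      ∀ (Lη : IwasawaAlgebra p), IsQuadraticBranchPlusLFunction f p ϖ Lη →
        PowerSeries.coeff 1 Lη ≠ 0 ∧ ¬ (p : ℤ_[p]) ∣ PowerSeries.coeff 3 Lη) :
    QuadraticBranchPlusEtaLowerInclusionAt V p ∧ QuadraticBranchPlusEtaMainConjectureAt V p := by
  obtain ⟨T, hpT, hT, -⟩ := exists_tamagawaFinset W p
  have hd0 : ((-1 : ℚ) ^ (p / 2) * p) ≠ 0 :=
    mul_ne_zero (pow_ne_zero _ (by norm_num)) (Nat.cast_ne_zero.mpr hp.out.ne_zero)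
  have hrk : (V.quadraticTwist ((-1) ^ (p / 2) * p)).mordellWeilRank = 1 := by
    rw [TamagawaRoad.mordellWeilRank_quadraticTwist_eq_of_smul_quadraticTwist_eq hd0 hCV, hr1]
  have hmem₁ : pl ℓ₁ ∈ T := hT (pl ℓ₁) (pl_ne_of_ne p hℓ₁.out (ne_of_split_of_smul_quadraticTwist_eq hp5 hCV hgood hs₁))
    (dvd_localTamagawaNumber_pl_of_split W p hs₁ hd₁)
  have hmem₂ : pl ℓ₂ ∈ T := hT (pl ℓ₂) (pl_ne_of_ne p hℓ₂.out (ne_of_split_of_smul_quadraticTwist_eq hp5 hCV hgood hs₂))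
    (dvd_localTamagawaNumber_pl_of_split W p hs₂ hd₂)
  have hne : pl ℓ₁ ≠ pl ℓ₂ := fun h => hℓ₁₂ (by
    have h1 := natGenerator_pl hℓ₁.out
    rw [h, natGenerator_pl hℓ₂.out] at h1
    exact h1.symm)
  have hc₁ := one_le_padicValNat_localTamagawaNumber_pl_of_split W p hs₁ hd₁
  have hc₂ := one_le_padicValNat_localTamagawaNumber_pl_of_split W p hs₂ hd₂
  -- every place of `T` leaves at least one of the two named primes in the rest of the sum
  have hrest : ∀ w ∈ T, padicValNat p ((W.baseChange (w.adicCompletion ℚ)).localTamagawaNumber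
      (w.adicCompletionIntegers ℚ)) + 1 ≤ ∑ w ∈ T, padicValNat p ((W.baseChange (w.adicCompletion ℚ)).localTamagawaNumber
        (w.adicCompletionIntegers ℚ)) := by
    intro w hw
    rw [← Finset.add_sum_erase T _ hw]
    refine Nat.add_le_add_left ?_ _
    by_cases hw₁ : w = pl ℓ₁
    · have hm : pl ℓ₂ ∈ T.erase w := Finset.mem_erase.mpr ⟨fun h => hne (hw₁ ▸ h.symm), hmem₂⟩
      exact hc₂.trans (TamagawaLocus.le_sum_of_mem (T.erase w)
        (fun x => padicValNat p ((W.baseChange (x.adicCompletion ℚ)).localTamagawaNumber (x.adicCompletionIntegers ℚ))) hm)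
    · have hm : pl ℓ₁ ∈ T.erase w := Finset.mem_erase.mpr ⟨fun h => hw₁ h.symm, hmem₁⟩
      exact hc₁.trans (TamagawaLocus.le_sum_of_mem (T.erase w)
        (fun x => padicValNat p ((W.baseChange (x.adicCompletion ℚ)).localTamagawaNumber (x.adicCompletionIntegers ℚ))) hm)
  have h2 : 2 ≤ ∑ w ∈ T, padicValNat p ((W.baseChange (w.adicCompletion ℚ)).localTamagawaNumber
      (w.adicCompletionIntegers ℚ)) := by
    have := hrest _ hmem₁
    omega
  refine etaPair_of_namedFacts_of_invol_of_unitCoeff_of_tamagawaLevel h12 h13 h22 h41 hKO hFE hPT hp5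
    hgood hap hsurj (fun f hf => hcertV f hf) ?_ W C hCV T hpT hT
    (∑ w ∈ T, padicValNat p ((W.baseChange (w.adicCompletion ℚ)).localTamagawaNumber
      (w.adicCompletionIntegers ℚ)) - 1) (by omega)
    (fun w hw => by have := hrest w hw; omega) ?_
  · intro N _ f hf ϖ hϖ Lη hL
    rw [hrk]
    exact han2 hf ϖ hϖ Lη hL
  · rw [hrk, mul_one]
    omega

end Stub

end Summit.BirchSwinnertonDyer.BirchSwinnertonDyer.Theorems

end
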